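import Mathlib.Algebra.MvPolynomial.PDeriv
import Mathlib.RingTheory.MvPolynomial.EulerIdentity
import Mathlib.RingTheory.MvPolynomial.Homogeneous
import Mathlib.LinearAlgebra.FiniteDimensional.Lemmas
import HarnessLib

/-!
# Spherical harmonics: the `𝔰𝔩₂` commutation relations and `𝒫ᵏ = ⊕ₚ r²ᵖ ℋᵏ⁻²ᵖ`

Goodman–Wallach, *Symmetry, Representations, and Invariants* (GTM 255), § 5.6.4
"Spherical Harmonics" [GoodmanWallachGTM255]. On the polynomial ring `𝒫 = k[x_σ]`
(`MvPolynomial σ k`, `σ` finite, `n = |σ|`) consider the operators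

  `Δ = ∑ᵢ ∂ᵢ²` (Laplacian), `r² = ∑ᵢ xᵢ²` (multiplication), `E = ∑ᵢ xᵢ ∂ᵢ` (Euler operator).

They are passed to the theorems below as hypotheses (`hΔ : ∀ f, Δ f = ∑ i, ∂ᵢ (∂ᵢ f)`,
`hr2 : r2 = ∑ i, X i ^ 2`), so that any concrete incarnation (e.g. a user's own `def`) can be
plugged in by `rfl`-type proofs. Everything is proved, over an arbitrary field `k`
(of characteristic `0` where the source uses it); no definitions, no named facts.

* § 1 `laplacian_isHomogeneous` (`Δ : 𝒫ᵈ → 𝒫ᵈ⁻²`), `laplacian_rsq_mul`, `euler_rsq_mul`,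
  `laplacian_euler` — the commutation relations
  (5.86): `[Δ, r²] = 4E + 2n`, `[E, r²] = 2r²`, `[E, Δ] = −2Δ`, hence
  `X = −½Δ, Y = ½r², H = −E − n/2` is a TDS (`𝔰𝔩₂`) triple;
  `laplacian_eq_zero_iff_forall_homogeneousComponent` — `ℋ = ⊕ₖ ℋᵏ`;
* § 2 `tds_highestWeight` — (5.87): a harmonic `f ∈ 𝒫ᵏ` satisfies `X f = 0`,
  `H f = −(k + n/2) f`; `laplacian_linearForm_pow` — `Δ(xᵐ) = m(m−1)(x,x) xᵐ⁻²` for the linear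
  form `x = ∑ cᵢ xᵢ`, so (`linearForm_pow_harmonic_of_isotropic`) powers of isotropic vectors are
  harmonic;
* § 3 `eq_zero_of_laplacian_rsq_mul_add_eq_zero`, `existsUnique_laplacian_rsq_mul_eq` — the
  `𝔰𝔩₂` mechanism behind (5.89)/(5.90): on `𝒫ᵈ` the operator `g ↦ Δ(r² g)` has only the positive
  eigenvalue shifts `4d + 2n`, hence `Δ ∘ r²` is a bijection of `𝒫ᵈ` (char `0`, `n ≥ 1`);
* § 4 `exists_harmonic_add_rsq_mul`, `harmonic_add_rsq_mul_unique`,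
  `homogeneousSubmodule_eq_harmonic_sup_rsq_mul`, `disjoint_ker_laplacian_rsq_mul` —
  `𝒫ᵈ⁺² = ℋᵈ⁺² ⊕ r² 𝒫ᵈ`, and `finrank_harmonic_add_finrank` — `dim ℋᵈ⁺² = dim 𝒫ᵈ⁺² − dim 𝒫ᵈ`;
* § 5 `exists_eq_sum_rsq_pow_mul_harmonic`, `eq_zero_of_sum_rsq_pow_mul_harmonic_eq_zero` —
  **Corollary 5.6.12 (5.90)**: `𝒫ᵐ = ⊕_{p=0}^{[m/2]} r²ᵖ ℋᵐ⁻²ᵖ` (existence and uniqueness of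
  the expansion of a homogeneous polynomial in solid harmonics).

The source works over `ℂ` with `n ≥ 3` (for the accompanying `O(n)`-theory); the statements
here hold over any field of characteristic `0` and any `n ≥ 1`, with the same proofs.

References: R. Goodman, N. R. Wallach, GTM 255, Springer 2009, § 5.6.4, (5.86), (5.87),
Theorem 5.6.11, Corollary 5.6.12 [GoodmanWallachGTM255].
-/

open MvPolynomial
open scoped BigOperators

universe u v

namespace Literature.RepresentationTheory.ClassicalInvariants.SphericalHarmonics

variable {k : Type u} [Field k] {σ : Type v} [Fintype σ]

/-! ## § 1. The operators `Δ`, `r²`, `E` and the commutation relations (5.86) -/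

/-- `∂ᵢ (∑ⱼ xⱼ²) = 2 xᵢ`. [folklore] -/
private theorem pderiv_sum_X_sq (i : σ) :
    pderiv i (∑ j : σ, (X j : MvPolynomial σ k) ^ 2) = 2 * X i := by
  rw [map_sum, Finset.sum_eq_single i]
  · rw [pderiv_pow, pderiv_X_self]; simp
  · intro j _ hji
    rw [pderiv_pow, pderiv_X_of_ne hji]; simp
  · intro h; exact absurd (Finset.mem_univ i) h

/-- `r² = ∑ xᵢ²` is homogeneous of degree `2`. [folklore] -/
private theorem rsq_isHomogeneous (r2 : MvPolynomial σ k) (hr2 : r2 = ∑ i : σ, X i ^ 2) :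
    r2.IsHomogeneous 2 := by
  rw [hr2]
  refine IsHomogeneous.sum _ _ _ fun i _ => ?_
  simpa using (isHomogeneous_X k i).pow 2

/-- `Δ : 𝒫ᵈ → 𝒫ᵈ⁻²` lowers the degree of a homogeneous polynomial by `2`.
[cite: GoodmanWallachGTM255, §5.6.4 (display preceding (5.87))] -/
theorem laplacian_isHomogeneous (Δ : MvPolynomial σ k →ₗ[k] MvPolynomial σ k)
    (hΔ : ∀ f, Δ f = ∑ i : σ, pderiv i (pderiv i f)) {f : MvPolynomial σ k} {d : ℕ}
    (hf : f.IsHomogeneous d) : (Δ f).IsHomogeneous (d - 2) := by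
  rw [hΔ]
  refine IsHomogeneous.sum _ _ _ fun i _ => ?_
  have h := (hf.pderiv (i := i)).pderiv (i := i)
  rwa [show d - 1 - 1 = d - 2 by omega] at h

/-- `Δ : 𝒫ᵈ → 𝒫ᵈ⁻² = 0` for `d ≤ 1`: homogeneous polynomials of degree `≤ 1` are harmonic
(`𝒫⁰ = ℋ⁰`, `𝒫¹ = ℋ¹`). [cite: GoodmanWallachGTM255, §5.6.4 (display preceding (5.87))] -/
theorem laplacian_eq_zero_of_isHomogeneous_of_lt_two (Δ : MvPolynomial σ k →ₗ[k] MvPolynomial σ k)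
    (hΔ : ∀ f, Δ f = ∑ i : σ, pderiv i (pderiv i f)) {f : MvPolynomial σ k} {d : ℕ}
    (hf : f.IsHomogeneous d) (hd : d < 2) : Δ f = 0 := by
  rw [hΔ]
  refine Finset.sum_eq_zero fun i _ => ?_
  have h1 : (pderiv i f).IsHomogeneous (d - 1) := hf.pderiv
  have h0 : (pderiv i f).IsHomogeneous 0 := by rwa [show d - 1 = 0 by omega] at h1
  rw [← totalDegree_zero_iff_isHomogeneous, totalDegree_eq_zero_iff_eq_C] at h0
  rw [h0, pderiv_C]

/-- `Δ(xⱼ g) = 2 ∂ⱼ g + xⱼ Δ g`. [folklore] -/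
private theorem laplacian_X_mul (Δ : MvPolynomial σ k →ₗ[k] MvPolynomial σ k)
    (hΔ : ∀ f, Δ f = ∑ i : σ, pderiv i (pderiv i f)) (j : σ) (g : MvPolynomial σ k) :
    Δ (X j * g) = 2 * pderiv j g + X j * Δ g := by
  classical
  have hterm : ∀ i, pderiv i (pderiv i (X j * g)) =
      2 * (Pi.single (M := fun _ => MvPolynomial σ k) i 1 j * pderiv i g) +
        X j * pderiv i (pderiv i g) := by
    intro i
    rw [pderiv_mul, pderiv_X, map_add, pderiv_mul, pderiv_mul, pderiv_X]
    have h0 : pderiv i (Pi.single (M := fun _ => MvPolynomial σ k) i 1 j) = 0 := by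
      by_cases hij : j = i
      · subst hij; simp
      · simp [hij]
    rw [h0]; ring
  rw [hΔ, hΔ g, Finset.mul_sum]
  simp_rw [hterm]
  rw [Finset.sum_add_distrib, ← Finset.mul_sum, ← Finset.mul_sum, Finset.sum_eq_single j]
  · simp
  · intro i _ hij; simp [Ne.symm hij]
  · intro h; exact absurd (Finset.mem_univ j) h

/-- `Δ` commutes with each `∂ⱼ`. [folklore] -/
private theorem laplacian_pderiv (Δ : MvPolynomial σ k →ₗ[k] MvPolynomial σ k)
    (hΔ : ∀ f, Δ f = ∑ i : σ, pderiv i (pderiv i f)) (j : σ) (f : MvPolynomial σ k) :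
    Δ (pderiv j f) = pderiv j (Δ f) := by
  classical
  -- partial derivatives commute (compare coefficients)
  have hcomm : ∀ (a b : σ) (p : MvPolynomial σ k), pderiv a (pderiv b p) = pderiv b (pderiv a p) := by
    intro a b p
    rcases eq_or_ne a b with rfl | hab
    · rfl
    ext m
    simp only [coeff_pderiv, Finsupp.add_apply, Finsupp.single_apply, if_neg hab,
      if_neg hab.symm, add_zero]
    rw [add_right_comm m (Finsupp.single a 1) (Finsupp.single b 1)]
    ring
  rw [hΔ, hΔ f, map_sum]
  refine Finset.sum_congr rfl fun i _ => ?_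
  rw [hcomm i j f, hcomm i j (pderiv i f)]

/-- **(5.86), third relation** `[Δ, r²] = 4(E + n/2)`, applied to `f`:
`Δ(r² f) = r² Δf + 4 Ef + 2n f`. [cite: GoodmanWallachGTM255, §5.6.4 (5.86)] -/
theorem laplacian_rsq_mul (Δ : MvPolynomial σ k →ₗ[k] MvPolynomial σ k)
    (hΔ : ∀ f, Δ f = ∑ i : σ, pderiv i (pderiv i f)) (r2 : MvPolynomial σ k)
    (hr2 : r2 = ∑ i : σ, X i ^ 2) (f : MvPolynomial σ k) :
    Δ (r2 * f) = r2 * Δ f + 4 * ∑ i : σ, X i * pderiv i f +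
      2 * (Fintype.card σ : MvPolynomial σ k) * f := by
  have hr : ∀ i : σ, pderiv i r2 = 2 * X i := by
    intro i; rw [hr2]; exact pderiv_sum_X_sq i
  have hterm : ∀ i : σ, pderiv i (pderiv i (r2 * f)) =
      2 * f + 4 * (X i * pderiv i f) + r2 * pderiv i (pderiv i f) := by
    intro i
    have e1 : pderiv i (r2 * f) = C 2 * (X i * f) + r2 * pderiv i f := by
      rw [pderiv_mul, hr, show (2 : MvPolynomial σ k) = C 2 from (map_ofNat C 2).symm]; ring
    have e2 : pderiv i (X i * f) = f + X i * pderiv i f := by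
      rw [pderiv_mul, pderiv_X_self]; ring
    have e3 : pderiv i (r2 * pderiv i f) = 2 * (X i * pderiv i f) + r2 * pderiv i (pderiv i f) := by
      rw [pderiv_mul, hr]; ring
    rw [e1, map_add, pderiv_C_mul, e2, e3, show (C 2 : MvPolynomial σ k) = 2 from map_ofNat C 2]
    ring
  rw [hΔ, hΔ f]
  simp_rw [hterm, Finset.sum_add_distrib, ← Finset.mul_sum]
  simp only [Finset.sum_const, Finset.card_univ, nsmul_eq_mul]
  ring

/-- **(5.86), second relation** `[E, r²] = 2r²`, applied to `f`:
`E(r² f) = r² Ef + 2 r² f`. [cite: GoodmanWallachGTM255, §5.6.4 (5.86)] -/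
theorem euler_rsq_mul (r2 : MvPolynomial σ k) (hr2 : r2 = ∑ i : σ, X i ^ 2)
    (f : MvPolynomial σ k) :
    ∑ i : σ, X i * pderiv i (r2 * f) = r2 * ∑ i : σ, X i * pderiv i f + 2 * (r2 * f) := by
  have hr : ∀ i : σ, pderiv i r2 = 2 * X i := by
    intro i; rw [hr2]; exact pderiv_sum_X_sq i
  have hterm : ∀ i : σ, X i * pderiv i (r2 * f) = 2 * (X i ^ 2 * f) + r2 * (X i * pderiv i f) := by
    intro i; rw [pderiv_mul, hr]; ring
  simp_rw [hterm, Finset.sum_add_distrib, ← Finset.mul_sum, ← Finset.sum_mul, ← hr2]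
  ring

/-- **(5.86), first relation** `[E, Δ] = −2Δ`, applied to `f`:
`Δ(E f) = E(Δ f) + 2 Δf`. [cite: GoodmanWallachGTM255, §5.6.4 (5.86)] -/
theorem laplacian_euler (Δ : MvPolynomial σ k →ₗ[k] MvPolynomial σ k)
    (hΔ : ∀ f, Δ f = ∑ i : σ, pderiv i (pderiv i f)) (f : MvPolynomial σ k) :
    Δ (∑ j : σ, X j * pderiv j f) = ∑ j : σ, X j * pderiv j (Δ f) + 2 * Δ f := by
  rw [map_sum]
  simp_rw [laplacian_X_mul Δ hΔ, laplacian_pderiv Δ hΔ]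
  rw [Finset.sum_add_distrib, ← Finset.mul_sum, ← hΔ f, add_comm]

/-- `Δ(r² g) = r² Δg + (4d + 2n) g` for `g` homogeneous of degree `d` (third relation of (5.86)
combined with Euler's identity `E g = d g`). [cite: GoodmanWallachGTM255, §5.6.4 (5.86)] -/
theorem laplacian_rsq_mul_of_isHomogeneous (Δ : MvPolynomial σ k →ₗ[k] MvPolynomial σ k)
    (hΔ : ∀ f, Δ f = ∑ i : σ, pderiv i (pderiv i f)) (r2 : MvPolynomial σ k)
    (hr2 : r2 = ∑ i : σ, X i ^ 2) {g : MvPolynomial σ k} {d : ℕ} (hg : g.IsHomogeneous d) :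
    Δ (r2 * g) = r2 * Δ g + ((4 * d + 2 * Fintype.card σ : ℕ) : MvPolynomial σ k) * g := by
  rw [laplacian_rsq_mul Δ hΔ r2 hr2, hg.sum_X_mul_pderiv, nsmul_eq_mul]
  push_cast
  ring

omit [Fintype σ] in
/-- Taking homogeneous components commutes with `∂ᵢ` (with the degree shift). [folklore] -/
private theorem homogeneousComponent_pderiv (n : ℕ) (i : σ) (f : MvPolynomial σ k) :
    homogeneousComponent n (pderiv i f) = pderiv i (homogeneousComponent (n + 1) f) := by
  classical
  ext m
  simp only [coeff_homogeneousComponent, coeff_pderiv, map_add, Finsupp.degree_single]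
  by_cases h : m.degree = n
  · rw [if_pos h, if_pos (by rw [h])]
  · rw [if_neg h, if_neg (by omega), zero_mul]

/-- Taking homogeneous components commutes with `Δ` (with the degree shift `2`). [folklore] -/
private theorem homogeneousComponent_laplacian (Δ : MvPolynomial σ k →ₗ[k] MvPolynomial σ k)
    (hΔ : ∀ f, Δ f = ∑ i : σ, pderiv i (pderiv i f)) (n : ℕ) (f : MvPolynomial σ k) :
    homogeneousComponent n (Δ f) = Δ (homogeneousComponent (n + 2) f) := by
  rw [hΔ, hΔ, map_sum]
  simp_rw [homogeneousComponent_pderiv]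

/-- `ℋ = ⊕ₖ ℋᵏ`: since `Δ : 𝒫ᵏ → 𝒫ᵏ⁻²`, a polynomial is harmonic if and only if each of its
homogeneous components is harmonic. [cite: GoodmanWallachGTM255, §5.6.4 (display preceding (5.87))] -/
theorem laplacian_eq_zero_iff_forall_homogeneousComponent
    (Δ : MvPolynomial σ k →ₗ[k] MvPolynomial σ k)
    (hΔ : ∀ f, Δ f = ∑ i : σ, pderiv i (pderiv i f)) (f : MvPolynomial σ k) :
    Δ f = 0 ↔ ∀ n, Δ (homogeneousComponent n f) = 0 := by
  constructor
  · intro h n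
    rcases Nat.lt_or_ge n 2 with hn | hn
    · exact laplacian_eq_zero_of_isHomogeneous_of_lt_two Δ hΔ
        (homogeneousComponent_isHomogeneous n f) hn
    · obtain ⟨d, rfl⟩ : ∃ d, n = d + 2 := ⟨n - 2, by omega⟩
      rw [← homogeneousComponent_laplacian Δ hΔ, h, map_zero]
  · intro h
    rw [← sum_homogeneousComponent (Δ f)]
    refine Finset.sum_eq_zero fun n _ => ?_
    rw [homogeneousComponent_laplacian Δ hΔ, h]

/-! ## § 2. (5.87): harmonic polynomials are `𝔰𝔩₂`-highest-weight vectors; isotropic powers -/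

/-- **(5.87).** For the TDS triple `X = −½Δ`, `Y = ½r²`, `H = −E − n/2` and a harmonic
polynomial `f` homogeneous of degree `m`: `X f = 0` and `H f = −(m + n/2) f`, i.e. `f` is a
highest-weight vector of weight `−(m + n/2)`. [cite: GoodmanWallachGTM255, §5.6.4 (5.87)] -/
theorem tds_highestWeight (Δ : MvPolynomial σ k →ₗ[k] MvPolynomial σ k) {f : MvPolynomial σ k}
    {m : ℕ} (hf : f.IsHomogeneous m) (hharm : Δ f = 0) :
    (-(1 / 2 : k)) • Δ f = 0 ∧
      -(∑ i : σ, X i * pderiv i f) - ((Fintype.card σ : k) / 2) • f =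
        (-((m : k) + (Fintype.card σ : k) / 2)) • f := by
  refine ⟨by rw [hharm, smul_zero], ?_⟩
  rw [hf.sum_X_mul_pderiv, ← Nat.cast_smul_eq_nsmul k]
  module

/-- The linear form `x = ∑ cᵢ xᵢ` has `∂ᵢ x = cᵢ`. [folklore] -/
private theorem pderiv_linearForm (c : σ → k) (i : σ) :
    pderiv i (∑ j : σ, C (c j) * (X j : MvPolynomial σ k)) = C (c i) := by
  classical
  rw [map_sum, Finset.sum_eq_single i]
  · rw [pderiv_C_mul, pderiv_X_self, mul_one]
  · intro j _ hji
    rw [pderiv_C_mul, pderiv_X_of_ne hji, mul_zero]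
  · intro h; exact absurd (Finset.mem_univ i) h

/-- The powers `xᵐ` of a linear form `x = ∑ cᵢ xᵢ` are homogeneous of degree `m`. [folklore] -/
private theorem linearForm_pow_isHomogeneous (c : σ → k) (m : ℕ) :
    ((∑ j : σ, C (c j) * (X j : MvPolynomial σ k)) ^ m).IsHomogeneous m := by
  have h1 : (∑ j : σ, C (c j) * (X j : MvPolynomial σ k)).IsHomogeneous 1 :=
    IsHomogeneous.sum _ _ _ fun j _ => isHomogeneous_C_mul_X (c j) j
  simpa using h1.pow m

/-- `Δ(xᵐ) = m(m−1)(x,x) xᵐ⁻²` for the linear form `x = ∑ cᵢ xᵢ`, `(x,x) = ∑ cᵢ²`.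
[cite: GoodmanWallachGTM255, §5.6.4 (display after (5.87))] -/
theorem laplacian_linearForm_pow (Δ : MvPolynomial σ k →ₗ[k] MvPolynomial σ k)
    (hΔ : ∀ f, Δ f = ∑ i : σ, pderiv i (pderiv i f)) (c : σ → k) (m : ℕ) :
    Δ ((∑ j : σ, C (c j) * (X j : MvPolynomial σ k)) ^ m) =
      C ((m : k) * ((m : k) - 1) * ∑ i : σ, c i ^ 2) *
        (∑ j : σ, C (c j) * (X j : MvPolynomial σ k)) ^ (m - 2) := by
  set φ : MvPolynomial σ k := ∑ j : σ, C (c j) * X j with hφ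
  have hd : ∀ i : σ, pderiv i φ = C (c i) := fun i => by rw [hφ]; exact pderiv_linearForm c i
  rw [hΔ]
  cases m with
  | zero => simp
  | succ s =>
    have hterm : ∀ i : σ, pderiv i (pderiv i (φ ^ (s + 1))) =
        C (c i ^ 2 * ((s + 1 : ℕ) : k) * (s : k)) * φ ^ (s - 1) := by
      intro i
      rw [pderiv_pow, hd, show ((s + 1 : ℕ) : MvPolynomial σ k) = C ((s + 1 : ℕ) : k) from
        (map_natCast C _).symm, Nat.add_sub_cancel,
        show C ((s + 1 : ℕ) : k) * φ ^ s * C (c i) = C (((s + 1 : ℕ) : k) * c i) * φ ^ s by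
          rw [map_mul]; ring,
        pderiv_C_mul, pderiv_pow, hd,
        show ((s : ℕ) : MvPolynomial σ k) = C ((s : ℕ) : k) from (map_natCast C _).symm]
      simp only [map_mul, map_pow]
      ring
    simp_rw [hterm]
    rw [← Finset.sum_mul, ← map_sum, ← Finset.sum_mul, ← Finset.sum_mul,
      show s + 1 - 2 = s - 1 by omega]
    congr 2
    push_cast
    ring

/-- Hence if `x` is isotropic, `(x,x) = ∑ cᵢ² = 0`, then `xᵐ ∈ ℋᵐ`: it is homogeneous of degree
`m` and harmonic. [cite: GoodmanWallachGTM255, §5.6.4 (display after (5.87))] -/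
theorem linearForm_pow_harmonic_of_isotropic (Δ : MvPolynomial σ k →ₗ[k] MvPolynomial σ k)
    (hΔ : ∀ f, Δ f = ∑ i : σ, pderiv i (pderiv i f)) {c : σ → k} (hc : ∑ i : σ, c i ^ 2 = 0)
    (m : ℕ) :
    ((∑ j : σ, C (c j) * (X j : MvPolynomial σ k)) ^ m).IsHomogeneous m ∧
      Δ ((∑ j : σ, C (c j) * (X j : MvPolynomial σ k)) ^ m) = 0 := by
  refine ⟨linearForm_pow_isHomogeneous c m, ?_⟩
  rw [laplacian_linearForm_pow Δ hΔ, hc]; simp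

/-! ## § 3. `Δ ∘ r²` is invertible on each `𝒫ᵈ` -/

omit [Fintype σ] in
/-- `Δ` commutes with multiplication by natural-number scalars. [folklore] -/
private theorem map_natCast_mul (Δ : MvPolynomial σ k →ₗ[k] MvPolynomial σ k) (N : ℕ)
    (g : MvPolynomial σ k) : Δ ((N : MvPolynomial σ k) * g) = (N : MvPolynomial σ k) * Δ g := by
  rw [← map_natCast C N, C_mul', C_mul', map_smul]

/-- **The `𝔰𝔩₂` mechanism.** If `g ∈ 𝒫ᵈ` and `Δ(r² g) + c g = 0` for a natural number `c`, then
`g = 0` (char `0`, `n ≥ 1`): by (5.86) `r² Δg = −(4d + 2n + c) g`; applying `Δ` shows that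
`Δg ∈ 𝒫ᵈ⁻²` satisfies the same kind of relation, so `Δg = 0` by induction on `d` (`Δ` is
locally nilpotent), whence `(4d + 2n + c) g = 0`. This is the positivity of the `H`-eigenvalues
on the lowest-weight modules (5.89). [cite: GoodmanWallachGTM255, §5.6.4 (5.86)–(5.89)] -/
theorem eq_zero_of_laplacian_rsq_mul_add_eq_zero [CharZero k] [Nonempty σ]
    (Δ : MvPolynomial σ k →ₗ[k] MvPolynomial σ k)
    (hΔ : ∀ f, Δ f = ∑ i : σ, pderiv i (pderiv i f)) (r2 : MvPolynomial σ k)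
    (hr2 : r2 = ∑ i : σ, X i ^ 2) {d : ℕ} {g : MvPolynomial σ k} (hg : g.IsHomogeneous d)
    (c : ℕ) (h : Δ (r2 * g) + (c : MvPolynomial σ k) * g = 0) : g = 0 := by
  induction d using Nat.strong_induction_on generalizing g c with
  | _ d ih =>
    have key : r2 * Δ g = -(((4 * d + 2 * Fintype.card σ + c : ℕ) : MvPolynomial σ k) * g) := by
      rw [laplacian_rsq_mul_of_isHomogeneous Δ hΔ r2 hr2 hg] at h
      refine eq_neg_of_add_eq_zero_left ?_
      rw [← h]
      push_cast
      ring
    have hΔg : Δ g = 0 := by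
      rcases Nat.lt_or_ge d 2 with hd | hd
      · exact laplacian_eq_zero_of_isHomogeneous_of_lt_two Δ hΔ hg hd
      · refine ih (d - 2) (by omega) (laplacian_isHomogeneous Δ hΔ hg)
          (4 * d + 2 * Fintype.card σ + c) ?_
        have h2 := congrArg Δ key
        rw [map_neg, map_natCast_mul] at h2
        rw [h2, neg_add_cancel]
    rw [hΔg, mul_zero, eq_comm, neg_eq_zero] at key
    have hN : ((4 * d + 2 * Fintype.card σ + c : ℕ) : MvPolynomial σ k) ≠ 0 := by
      have : 0 < Fintype.card σ := Fintype.card_pos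
      exact Nat.cast_ne_zero.mpr (by omega)
    exact (mul_eq_zero.mp key).resolve_left hN

/-- In particular `Δ ∘ r²` is injective on `𝒫ᵈ`. [cite: GoodmanWallachGTM255, §5.6.4] -/
theorem eq_of_laplacian_rsq_mul_eq [CharZero k] [Nonempty σ]
    (Δ : MvPolynomial σ k →ₗ[k] MvPolynomial σ k)
    (hΔ : ∀ f, Δ f = ∑ i : σ, pderiv i (pderiv i f)) (r2 : MvPolynomial σ k)
    (hr2 : r2 = ∑ i : σ, X i ^ 2) {d : ℕ} {g g' : MvPolynomial σ k} (hg : g.IsHomogeneous d)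
    (hg' : g'.IsHomogeneous d) (h : Δ (r2 * g) = Δ (r2 * g')) : g = g' := by
  rw [← sub_eq_zero]
  refine eq_zero_of_laplacian_rsq_mul_add_eq_zero Δ hΔ r2 hr2 (hg.sub hg') 0 ?_
  rw [mul_sub, map_sub, h, sub_self, Nat.cast_zero, zero_mul, add_zero]

/-- **`Δ ∘ r² : 𝒫ᵈ → 𝒫ᵈ` is a bijection** (char `0`, `n ≥ 1`): injective by
`eq_zero_of_laplacian_rsq_mul_add_eq_zero`, hence bijective since `𝒫ᵈ` is finite-dimensional.
[cite: GoodmanWallachGTM255, §5.6.4 (proof of Theorem 5.6.11)] -/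
theorem existsUnique_laplacian_rsq_mul_eq [CharZero k] [Nonempty σ]
    (Δ : MvPolynomial σ k →ₗ[k] MvPolynomial σ k)
    (hΔ : ∀ f, Δ f = ∑ i : σ, pderiv i (pderiv i f)) (r2 : MvPolynomial σ k)
    (hr2 : r2 = ∑ i : σ, X i ^ 2) {d : ℕ} {f : MvPolynomial σ k} (hf : f.IsHomogeneous d) :
    ∃! g : MvPolynomial σ k, g.IsHomogeneous d ∧ Δ (r2 * g) = f := by
  haveI : Module.Finite k (homogeneousSubmodule σ k d) :=
    Module.Finite.iff_fg.mpr (homogeneousSubmodule_fg σ k d)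
  have hmem : ∀ g : MvPolynomial σ k, g.IsHomogeneous d → (Δ (r2 * g)).IsHomogeneous d := by
    intro g hg
    have h := laplacian_isHomogeneous Δ hΔ ((rsq_isHomogeneous r2 hr2).mul hg)
    rwa [Nat.add_sub_cancel_left] at h
  let L : homogeneousSubmodule σ k d →ₗ[k] homogeneousSubmodule σ k d :=
    { toFun := fun g => ⟨Δ (r2 * (g : MvPolynomial σ k)),
        (mem_homogeneousSubmodule d _).mpr (hmem g ((mem_homogeneousSubmodule d _).mp g.2))⟩
      map_add' := fun g g' => by
        ext
        simp [mul_add, map_add]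
      map_smul' := fun a g => by
        ext
        simp [map_smul] }
  have hL : ∀ g : homogeneousSubmodule σ k d, ((L g : homogeneousSubmodule σ k d) :
      MvPolynomial σ k) = Δ (r2 * (g : MvPolynomial σ k)) := fun g => rfl
  have hinj : Function.Injective L := by
    intro g g' hgg'
    apply Subtype.ext
    refine eq_of_laplacian_rsq_mul_eq Δ hΔ r2 hr2 ((mem_homogeneousSubmodule d _).mp g.2)
      ((mem_homogeneousSubmodule d _).mp g'.2) ?_
    rw [← hL, ← hL, hgg']
  have hsurj : Function.Surjective L := LinearMap.injective_iff_surjective.mp hinj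
  obtain ⟨g, hg⟩ := hsurj ⟨f, (mem_homogeneousSubmodule d _).mpr hf⟩
  refine ⟨g, ⟨(mem_homogeneousSubmodule d _).mp g.2, by rw [← hL, hg]⟩, ?_⟩
  rintro g' ⟨hg'1, hg'2⟩
  refine eq_of_laplacian_rsq_mul_eq Δ hΔ r2 hr2 hg'1 ((mem_homogeneousSubmodule d _).mp g.2) ?_
  rw [hg'2, ← hL, hg]

/-! ## § 4. `𝒫ᵈ⁺² = ℋᵈ⁺² ⊕ r² 𝒫ᵈ` -/

/-- **Existence of the harmonic part**: every `f ∈ 𝒫ᵈ⁺²` is `f = h + r² g` with `h ∈ ℋᵈ⁺²`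
harmonic and `g ∈ 𝒫ᵈ` (char `0`, `n ≥ 1`). [cite: GoodmanWallachGTM255, Corollary 5.6.12] -/
theorem exists_harmonic_add_rsq_mul [CharZero k] [Nonempty σ]
    (Δ : MvPolynomial σ k →ₗ[k] MvPolynomial σ k)
    (hΔ : ∀ f, Δ f = ∑ i : σ, pderiv i (pderiv i f)) (r2 : MvPolynomial σ k)
    (hr2 : r2 = ∑ i : σ, X i ^ 2) {d : ℕ} {f : MvPolynomial σ k} (hf : f.IsHomogeneous (d + 2)) :
    ∃ h g : MvPolynomial σ k,
      h.IsHomogeneous (d + 2) ∧ Δ h = 0 ∧ g.IsHomogeneous d ∧ f = h + r2 * g := by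
  have hΔf : (Δ f).IsHomogeneous d := by
    simpa using laplacian_isHomogeneous Δ hΔ hf
  obtain ⟨g, ⟨hg, hgf⟩, -⟩ := existsUnique_laplacian_rsq_mul_eq Δ hΔ r2 hr2 hΔf
  refine ⟨f - r2 * g, g, hf.sub ?_, by rw [map_sub, hgf, sub_self], hg, (sub_add_cancel _ _).symm⟩
  simpa [add_comm] using (rsq_isHomogeneous r2 hr2).mul hg

/-- **Uniqueness of the harmonic part**: if `h + r² g = h' + r² g'` with `h, h'` harmonic and
`g, g' ∈ 𝒫ᵈ`, then `g = g'` and `h = h'`. [cite: GoodmanWallachGTM255, Corollary 5.6.12] -/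
theorem harmonic_add_rsq_mul_unique [CharZero k] [Nonempty σ]
    (Δ : MvPolynomial σ k →ₗ[k] MvPolynomial σ k)
    (hΔ : ∀ f, Δ f = ∑ i : σ, pderiv i (pderiv i f)) (r2 : MvPolynomial σ k)
    (hr2 : r2 = ∑ i : σ, X i ^ 2) {d : ℕ} {h h' g g' : MvPolynomial σ k} (hh : Δ h = 0)
    (hh' : Δ h' = 0) (hg : g.IsHomogeneous d) (hg' : g'.IsHomogeneous d)
    (e : h + r2 * g = h' + r2 * g') : g = g' ∧ h = h' := by
  have hgg' : g = g' := by
    refine eq_of_laplacian_rsq_mul_eq Δ hΔ r2 hr2 hg hg' ?_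
    have := congrArg Δ e
    rwa [map_add, map_add, hh, hh', zero_add, zero_add] at this
  subst hgg'
  exact ⟨rfl, add_right_cancel e⟩

/-- `ℋ ∩ r² 𝒫ᵈ = 0`: no nonzero multiple `r² g` of a form `g ∈ 𝒫ᵈ` is harmonic.
[cite: GoodmanWallachGTM255, Corollary 5.6.12] -/
theorem disjoint_ker_laplacian_rsq_mul [CharZero k] [Nonempty σ]
    (Δ : MvPolynomial σ k →ₗ[k] MvPolynomial σ k)
    (hΔ : ∀ f, Δ f = ∑ i : σ, pderiv i (pderiv i f)) (r2 : MvPolynomial σ k)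
    (hr2 : r2 = ∑ i : σ, X i ^ 2) (d : ℕ) :
    Disjoint (LinearMap.ker Δ) ((homogeneousSubmodule σ k d).map (LinearMap.mulLeft k r2)) := by
  rw [Submodule.disjoint_def]
  rintro x hx ⟨g, hg, rfl⟩
  rw [LinearMap.mem_ker, LinearMap.mulLeft_apply] at hx
  have hg0 : g = 0 :=
    eq_zero_of_laplacian_rsq_mul_add_eq_zero Δ hΔ r2 hr2
      ((mem_homogeneousSubmodule d _).mp hg) 0 (by rw [hx, Nat.cast_zero, zero_mul, add_zero])
  rw [hg0, LinearMap.mulLeft_apply, mul_zero]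

/-- **`𝒫ᵈ⁺² = ℋᵈ⁺² + r² 𝒫ᵈ`** as submodules of `k[x]` (with `disjoint_ker_laplacian_rsq_mul`
the sum is direct). [cite: GoodmanWallachGTM255, Corollary 5.6.12] -/
theorem homogeneousSubmodule_eq_harmonic_sup_rsq_mul [CharZero k] [Nonempty σ]
    (Δ : MvPolynomial σ k →ₗ[k] MvPolynomial σ k)
    (hΔ : ∀ f, Δ f = ∑ i : σ, pderiv i (pderiv i f)) (r2 : MvPolynomial σ k)
    (hr2 : r2 = ∑ i : σ, X i ^ 2) (d : ℕ) :
    homogeneousSubmodule σ k (d + 2) =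
      (homogeneousSubmodule σ k (d + 2) ⊓ LinearMap.ker Δ) ⊔
        (homogeneousSubmodule σ k d).map (LinearMap.mulLeft k r2) := by
  refine le_antisymm ?_ ?_
  · intro f hf
    obtain ⟨h, g, hh, hh0, hg, rfl⟩ :=
      exists_harmonic_add_rsq_mul Δ hΔ r2 hr2 ((mem_homogeneousSubmodule _ _).mp hf)
    refine Submodule.add_mem_sup ⟨(mem_homogeneousSubmodule _ _).mpr hh, ?_⟩
      ⟨g, (mem_homogeneousSubmodule _ _).mpr hg, rfl⟩
    rw [SetLike.mem_coe, LinearMap.mem_ker, hh0]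
  · refine sup_le inf_le_left ?_
    rintro _ ⟨g, hg, rfl⟩
    rw [LinearMap.mulLeft_apply, mem_homogeneousSubmodule]
    simpa [add_comm] using
      (rsq_isHomogeneous r2 hr2).mul ((mem_homogeneousSubmodule d _).mp hg)

/-- `r² ≠ 0` when there is at least one variable (its `xᵢ²`-coefficient is `1`). [folklore] -/
private theorem rsq_ne_zero [Nonempty σ] (r2 : MvPolynomial σ k) (hr2 : r2 = ∑ i : σ, X i ^ 2) :
    r2 ≠ 0 := by
  classical
  obtain ⟨i⟩ := ‹Nonempty σ›
  intro h
  have hc : coeff (Finsupp.single i 2) r2 = 1 := by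
    rw [hr2, coeff_sum, Finset.sum_eq_single i]
    · rw [X_pow_eq_monomial, coeff_monomial, if_pos rfl]
    · intro j _ hji
      rw [X_pow_eq_monomial, coeff_monomial, if_neg]
      exact fun e => hji (Finsupp.single_left_injective (by norm_num) e)
    · intro hi; exact absurd (Finset.mem_univ i) hi
  rw [h, coeff_zero] at hc
  exact zero_ne_one hc

/-- **`dim ℋᵈ⁺² + dim 𝒫ᵈ = dim 𝒫ᵈ⁺²`** (immediate from `𝒫ᵈ⁺² = ℋᵈ⁺² ⊕ r² 𝒫ᵈ` and the
injectivity of multiplication by `r²`; char `0`, `n ≥ 1`).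
[cite: GoodmanWallachGTM255, Corollary 5.6.12] -/
theorem finrank_harmonic_add_finrank [CharZero k] [Nonempty σ]
    (Δ : MvPolynomial σ k →ₗ[k] MvPolynomial σ k)
    (hΔ : ∀ f, Δ f = ∑ i : σ, pderiv i (pderiv i f)) (r2 : MvPolynomial σ k)
    (hr2 : r2 = ∑ i : σ, X i ^ 2) (d : ℕ) :
    Module.finrank k ↥(homogeneousSubmodule σ k (d + 2) ⊓ LinearMap.ker Δ) +
        Module.finrank k ↥(homogeneousSubmodule σ k d) =
      Module.finrank k ↥(homogeneousSubmodule σ k (d + 2)) := by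
  haveI : Module.Finite k (homogeneousSubmodule σ k d) :=
    Module.Finite.iff_fg.mpr (homogeneousSubmodule_fg σ k d)
  haveI : Module.Finite k (homogeneousSubmodule σ k (d + 2)) :=
    Module.Finite.iff_fg.mpr (homogeneousSubmodule_fg σ k (d + 2))
  haveI : Module.Finite k ↥(homogeneousSubmodule σ k (d + 2) ⊓ LinearMap.ker Δ) :=
    FiniteDimensional.of_injective (Submodule.inclusion inf_le_left) (Submodule.inclusion_injective _)
  have hinf : (homogeneousSubmodule σ k (d + 2) ⊓ LinearMap.ker Δ) ⊓
      (homogeneousSubmodule σ k d).map (LinearMap.mulLeft k r2) = ⊥ :=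
    disjoint_iff.mp ((disjoint_ker_laplacian_rsq_mul Δ hΔ r2 hr2 d).mono_left inf_le_right)
  have h1 := Submodule.finrank_sup_add_finrank_inf_eq
    (homogeneousSubmodule σ k (d + 2) ⊓ LinearMap.ker Δ)
    ((homogeneousSubmodule σ k d).map (LinearMap.mulLeft k r2))
  rw [hinf, finrank_bot, add_zero, ← homogeneousSubmodule_eq_harmonic_sup_rsq_mul Δ hΔ r2 hr2 d]
    at h1
  have hinj : Function.Injective (LinearMap.mulLeft k r2) := fun x y hxy =>
    mul_right_injective₀ (rsq_ne_zero r2 hr2) (by simpa [LinearMap.mulLeft_apply] using hxy)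
  rw [h1, (Submodule.equivMapOfInjective _ hinj (homogeneousSubmodule σ k d)).finrank_eq]

/-! ## § 5. Corollary 5.6.12: `𝒫ᵐ = ⊕_{p=0}^{[m/2]} r²ᵖ ℋᵐ⁻²ᵖ` (5.90) -/

/-- **Corollary 5.6.12 (5.90), existence.** Every `f ∈ 𝒫ᵐ` is
`f = ∑_{p=0}^{[m/2]} r²ᵖ hₚ` with `hₚ ∈ ℋᵐ⁻²ᵖ` harmonic and homogeneous of degree `m − 2p`
(char `0`, `n ≥ 1`; the family `h` is indexed by all `p ∈ ℕ` and vanishes for `2p > m`).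
[cite: GoodmanWallachGTM255, Corollary 5.6.12 (5.90)] -/
theorem exists_eq_sum_rsq_pow_mul_harmonic [CharZero k] [Nonempty σ]
    (Δ : MvPolynomial σ k →ₗ[k] MvPolynomial σ k)
    (hΔ : ∀ f, Δ f = ∑ i : σ, pderiv i (pderiv i f)) (r2 : MvPolynomial σ k)
    (hr2 : r2 = ∑ i : σ, X i ^ 2) {m : ℕ} {f : MvPolynomial σ k} (hf : f.IsHomogeneous m) :
    ∃ h : ℕ → MvPolynomial σ k,
      (∀ p, (h p).IsHomogeneous (m - 2 * p)) ∧ (∀ p, Δ (h p) = 0) ∧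
        (∀ p, m < 2 * p → h p = 0) ∧ f = ∑ p ∈ Finset.range (m / 2 + 1), r2 ^ p * h p := by
  induction m using Nat.strong_induction_on generalizing f with
  | _ m ih =>
    rcases Nat.lt_or_ge m 2 with hm | hm
    · -- `𝒫ᵐ = ℋᵐ` for `m ≤ 1`
      refine ⟨fun p => if p = 0 then f else 0, fun p => ?_, fun p => ?_, fun p hp => ?_, ?_⟩
      · by_cases hp : p = 0
        · simp [hp, hf]
        · simp [hp, isHomogeneous_zero]
      · by_cases hp : p = 0
        · simp [hp, laplacian_eq_zero_of_isHomogeneous_of_lt_two Δ hΔ hf hm]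
        · simp [hp]
      · have : p ≠ 0 := by rintro rfl; omega
        simp [this]
      · rw [show m / 2 + 1 = 1 by omega]
        simp
    · obtain ⟨d, rfl⟩ : ∃ d, m = d + 2 := ⟨m - 2, by omega⟩
      obtain ⟨h0, g, hh0, hh0Δ, hg, rfl⟩ := exists_harmonic_add_rsq_mul Δ hΔ r2 hr2 hf
      obtain ⟨h', hh'1, hh'2, hh'3, hg'⟩ := ih d (by omega) hg
      refine ⟨fun p => Nat.casesOn p h0 h', fun p => ?_, fun p => ?_, fun p hp => ?_, ?_⟩
      · cases p with
        | zero => simpa using hh0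
        | succ p =>
          have e : d + 2 - 2 * (p + 1) = d - 2 * p := by omega
          simpa [e] using hh'1 p
      · cases p with
        | zero => simpa using hh0Δ
        | succ p => simpa using hh'2 p
      · cases p with
        | zero => omega
        | succ p => simpa using hh'3 p (by omega)
      · rw [show (d + 2) / 2 + 1 = d / 2 + 1 + 1 by omega, Finset.sum_range_succ', hg',
          Finset.mul_sum, add_comm]
        simp only [pow_zero, one_mul, pow_succ]
        congr 1
        refine Finset.sum_congr rfl fun p _ => ?_
        ring

/-- **Corollary 5.6.12 (5.90), uniqueness** (the sum is direct; equivalently the multiplication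
map `k[r²] ⊗ ℋ → 𝒫` is injective): if `∑_{p=0}^{[m/2]} r²ᵖ hₚ = 0` with `hₚ ∈ ℋᵐ⁻²ᵖ`
(and `hₚ = 0` for `2p > m`), then all `hₚ = 0` (char `0`, `n ≥ 1`).
[cite: GoodmanWallachGTM255, Corollary 5.6.12 (5.90), Theorem 5.6.11 (2)] -/
theorem eq_zero_of_sum_rsq_pow_mul_harmonic_eq_zero [CharZero k] [Nonempty σ]
    (Δ : MvPolynomial σ k →ₗ[k] MvPolynomial σ k)
    (hΔ : ∀ f, Δ f = ∑ i : σ, pderiv i (pderiv i f)) (r2 : MvPolynomial σ k)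
    (hr2 : r2 = ∑ i : σ, X i ^ 2) {m : ℕ} {h : ℕ → MvPolynomial σ k}
    (hhom : ∀ p, (h p).IsHomogeneous (m - 2 * p)) (hharm : ∀ p, Δ (h p) = 0)
    (hzero : ∀ p, m < 2 * p → h p = 0)
    (hsum : ∑ p ∈ Finset.range (m / 2 + 1), r2 ^ p * h p = 0) : ∀ p, h p = 0 := by
  induction m using Nat.strong_induction_on generalizing h with
  | _ m ih =>
    rcases Nat.lt_or_ge m 2 with hm | hm
    · intro p
      cases p with
      | zero =>
        rw [show m / 2 + 1 = 1 by omega] at hsum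
        simpa using hsum
      | succ p => exact hzero (p + 1) (by omega)
    · obtain ⟨d, rfl⟩ : ∃ d, m = d + 2 := ⟨m - 2, by omega⟩
      -- split off the `p = 0` term: `h 0 + r² G = 0` with `G = ∑ r²ᵖ h (p+1) ∈ 𝒫ᵈ`
      set G : MvPolynomial σ k := ∑ p ∈ Finset.range (d / 2 + 1), r2 ^ p * h (p + 1) with hG
      have hsum' : h 0 + r2 * G = 0 + r2 * 0 := by
        rw [show (d + 2) / 2 + 1 = d / 2 + 1 + 1 by omega, Finset.sum_range_succ'] at hsum
        rw [mul_zero, add_zero, ← hsum, hG, Finset.mul_sum, add_comm, pow_zero, one_mul]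
        congr 1
        refine Finset.sum_congr rfl fun p _ => ?_
        rw [pow_succ]; ring
      have hGhom : G.IsHomogeneous d := by
        rw [hG]
        refine IsHomogeneous.sum _ _ _ fun p hp => ?_
        have hp' : 2 * p ≤ d := by
          have := Finset.mem_range.mp hp; omega
        have h1 := ((rsq_isHomogeneous r2 hr2).pow p).mul (hhom (p + 1))
        rwa [show 2 * p + (d + 2 - 2 * (p + 1)) = d by omega] at h1
      obtain ⟨hG0, hh0⟩ := harmonic_add_rsq_mul_unique Δ hΔ r2 hr2 (hharm 0) (map_zero Δ) hGhom
        (isHomogeneous_zero σ k d) hsum'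
      have hrest : ∀ p, h (p + 1) = 0 := by
        refine ih d (by omega) (h := fun p => h (p + 1)) (fun p => ?_) (fun p => hharm (p + 1))
          (fun p hp => hzero (p + 1) (by omega)) (by rw [← hG0])
        have e : d + 2 - 2 * (p + 1) = d - 2 * p := by omega
        simpa [e] using hhom (p + 1)
      intro p
      cases p with
      | zero => exact hh0
      | succ p => exact hrest p

end Literature.RepresentationTheory.ClassicalInvariants.SphericalHarmonics
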